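import Literature.MathematicalPhysics.QuantumFieldTheory.Balaban1983to89.Beta.BalabanCompositeJets

/-!
# `BalabanUV.Beta.GAN24.LagrIncLevelZero` — binder row G-an2-4 / (CONV-C), S-slot road «S3», bridge «AVGLIFT-ONE*»:
# `avgLift 1 = id`, hence the level-`0` Lagrange piece of `S₀` IS the Lagrange increment `lagrInc d Lc 1 Lc` — rows S3-L0 and S3-L
# (and S3-Lt) are ONE family `lagrInc d Lc (Lc^ℓ) (Lc^{ℓ+1})`, `ℓ ≥ 0`

NOT IN PRINT; OUR PROOF ATTEMPT (unit b2b-balaban-gan24-formalise-leaf-03, gen 14; NEUTRAL name outside `StencilSlot*`; OFFER CLAIMS l.4826 (4)).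
HONEST FRAMING (cell contract, verbatim): «discharging `BetaPertH` makes Bałaban's UV stability UNCONDITIONAL — a real constructive-QFT
result; it is NOT the continuum limit and NOT the Clay problem.»  HONEST DEPENDENCY (verbatim): «continuum YM on T⁴ ⇐ BetaPertH ∧ nine spine
estimates (0/9 proved); BetaPertH ⇐ (D1) ∧ (D4) ∧ CAP+tail; G-an2-4 gates asym, D1 and NE2/3/4.»  [folklore] three-line bookkeeping over an2's
DEFINITIONS `InterLevelTransport.avgLift`, `BalabanCompositeJets.lagrInc`, with `HessianTelescopingKKT.legSet_one`∕`legW_one`∕`legPt_one`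
(the ingredients of its `dec_one`) BY NAME; generic `d`, `Lc`; 0 cite, 0 `def`, no estimate; NOTHING of (hS, hSall) ∕ «E3Shape» ∕ «E3SupRate» is
discharged.  NOT summit progress.

WHY.  The S-slot SHAPE table types the level-`0` Lagrange row S3-L0 on the piece `SLam Lc (lamCoeffOf (KInv Lc) Lc) (hessFF Lc)` of `S₀`
(`BalabanStepJets.S0`) and the level-`ℓ ≥ 1` rows S3-L ∕ S3-Lt on `lagrInc d Lc (Lc^ℓ) (Lc^{ℓ+1}) = SLam (Lc^{ℓ+1}) (lamCoeffOf (KInv (Lc^{ℓ+1}))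
(Lc^{ℓ+1})) (avgLift (Lc^ℓ) ∘ hessFF Lc)`.  Since the averaging lift by the factor `1` is the identity (§1), the former is LITERALLY the latter at
`ℓ = 0` (§2), with the row's weight `c^k·cΛ = c^k·cΛ·(Lc^0)^{2d+4}` (§2) — so ONE row assembler stated for `ℓ ≥ 0` in the shape of
`E3UnitSplitLevels.e3Lam_unit_split` serves S3-L (`ℓ = m+1`, `k = n−m`), S3-Lt (`k = 0`) and S3-L0 (`ℓ = 0`, `k = n+1`) by rewriting the stencil
family under `E3UnitSplit.e3OfS` (`congrArg`).

WHAT IS PROVED (0 sorry): §1 `legOff_one`, **`avgLift_one : avgLift 1 G = G`** (over `HessianTelescopingKKT.legSet_one`∕`legW_one`∕`legPt_one`); §2 **`lagrInc_one`**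
(`lagrInc d Lc 1 Lc κ u = SLam Lc (lamCoeffOf (KInv (N := Lc)) Lc) (fun μ y ↦ hessFF Lc μ y) κ u`), `lagrInc_congr` (blocking enters by value),
`lagrInc_level_zero` (the `Lc^0`, `Lc^(0+1)` form), **`lamPiece_level_zero`** (the S3-L0 family with weight `c^k·cΛ` equals the `ℓ = 0` instance of
the S3-L family pattern with weight `c^k·(cΛ·(Lc^0)^{2d+4})` on `lagrInc d Lc (Lc^0) (Lc^(0+1))`).
-/

noncomputable section

open Literature.MathematicalPhysics.QuantumFieldTheory.LatticeForm (quo)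
open Literature.MathematicalPhysics.QuantumFieldTheory.Balaban1983to89
open Literature.MathematicalPhysics.QuantumFieldTheory.Balaban1983to89.Beta
open OneStepResolventKernel (Fib KInv)
open OneStepKernelFamily (legSet legW legPt)
open HessianTelescopingKKT (legSet_one legW_one legPt_one)
open InterLevelTransport (SLam avgLift legOff)
open AveragingHessianKernels (hessFF)
open BalabanStepJets (lamCoeffOf)
open BalabanCompositeJets (lagrInc)
open ResolventComposition (quo_one proj_eq_zero_of_eq_one)

namespace Summit.QuantumFields.BalabanUV.Beta.GAN24.LagrIncLevelZero

variable {d : ℕ}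

/-! ## §1 The averaging lift by the factor `1` is the identity -/

/-- [folklore] At `M = 1` the leg offset of the single index vanishes (`HessianTelescopingKKT.legPt_one` at the origin). -/
theorem legOff_one (c : Fib d) : legOff (d := d) 1 c (fun _ => 0, 0) = 0 :=
  legPt_one c 0

/-- [folklore] **`avgLift 1 = id`**: pulling a kernel back through the block-contour averaging by the factor `1` does nothing (one leg index,
weight `1`, offset `0`, `proj 1 = 0`, `quo 1 = id`). -/
theorem avgLift_one (G : ExpKernelCalculus.MKer (d + 1) (Fib d)) : avgLift 1 G = G := by
  funext x w a b
  simp only [avgLift, legSet_one, Finset.sum_singleton, legW_one, one_mul, legOff_one, sub_zero,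
    proj_eq_zero_of_eq_one rfl, and_self, if_true, quo_one]  -- `legSet_one`∕`legW_one`: `HessianTelescopingKKT` BY NAME

/-! ## §2 The level-`0` Lagrange piece of `S₀` is the Lagrange increment at `M = 1` -/

/-- [folklore] **`lagrInc d Lc 1 Lc` IS `S₀`'s LAGRANGE STENCIL**: `lagrInc d Lc 1 Lc κ u = SLam Lc (lamCoeffOf (KInv (N := Lc)) Lc) (hessFF Lc) κ u`. -/
theorem lagrInc_one (Lc : ℕ) [NeZero Lc] (κ : Fin (d + 1)) (u : Fin (d + 1) → ℤ) :
    lagrInc d Lc 1 Lc κ u = SLam Lc (lamCoeffOf (KInv (N := Lc) (d := d)) Lc) (fun μ y => hessFF Lc μ y) κ u := by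
  simp only [lagrInc, avgLift_one]

/-- [folklore] The Lagrange increment depends on the blocking `N′` only through its value (the `NeZero` instance is a proof). -/
theorem lagrInc_congr (Lc M : ℕ) {N' N'' : ℕ} [NeZero N'] [NeZero N''] (h : N' = N'') (κ : Fin (d + 1)) (u : Fin (d + 1) → ℤ) :
    lagrInc d Lc M N' κ u = lagrInc d Lc M N'' κ u := by
  subst h
  rfl

/-- [folklore] The same bridge in the literal `ℓ = 0` form of the level family `lagrInc d Lc (Lc^ℓ) (Lc^(ℓ+1))`. -/
theorem lagrInc_level_zero (Lc : ℕ) [NeZero Lc] (κ : Fin (d + 1)) (u : Fin (d + 1) → ℤ) :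
    lagrInc d Lc (Lc ^ 0) (Lc ^ (0 + 1)) κ u = SLam Lc (lamCoeffOf (KInv (N := Lc) (d := d)) Lc) (fun μ y => hessFF Lc μ y) κ u := by
  have h : Lc ^ (0 + 1) = Lc := by rw [zero_add, pow_one]
  rw [pow_zero, lagrInc_congr Lc 1 h, lagrInc_one]

/-- [folklore] **ROW S3-L0's STENCIL FAMILY IS THE `ℓ = 0` INSTANCE OF ROW S3-L's**: with the SHAPE table's weights (`c = Lc^{d+1}`, `k` pushes),
`(c^k·cΛ) • SLam Lc (lamCoeffOf (KInv Lc) Lc) (hessFF Lc) κ u = (c^k·(cΛ·(Lc^0)^{2d+4})) • lagrInc d Lc (Lc^0) (Lc^{0+1}) κ u` — the literal argument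
of `E3UnitSplitLevels.e3Lam_unit_split` at `ℓ = 0`; rewrite under `e3OfS` with `congrArg`. -/
theorem lamPiece_level_zero (Lc : ℕ) [NeZero Lc] (cΛ : ℝ) (k : ℕ) :
    (fun (κ : Fin (d + 1)) (u : Fin (d + 1) → ℤ) =>
        (((Lc : ℝ) ^ (d + 1)) ^ k * cΛ) • SLam Lc (lamCoeffOf (KInv (N := Lc) (d := d)) Lc) (fun μ y => hessFF Lc μ y) κ u) =
      fun κ u => (((Lc : ℝ) ^ (d + 1)) ^ k * (cΛ * ((Lc : ℝ) ^ 0) ^ (2 * d + 4))) • lagrInc d Lc (Lc ^ 0) (Lc ^ (0 + 1)) κ u := by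
  funext κ u
  rw [lagrInc_level_zero, pow_zero, one_pow, mul_one]

end Summit.QuantumFields.BalabanUV.Beta.GAN24.LagrIncLevelZero

end
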